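import Summits.Ventures.HodgeRepro2.T5BergmanSchurPolarized
import Summits.Ventures.HodgeRepro2.T5BergmanSchurGeneralU11

/-!
# The Schur orthogonality relations on `H_j = U(1,1)`

The polarised relations of `T5BergmanSchurPolarized` (`schur_relations`, on `SU(1,1)` against Rühl's
measure) are transported to `U(1,1) = Z · SU(1,1)`: the product `⟨π_k(g) f₁, h₁⟩_k conj ⟨π_k(g) f₂, h₂⟩_k`
is invariant under the centre (the central character `λ^k` cancels against its conjugate,
`matrixCoeffU_mul_conj_mulHom`), it is continuous (through the quotient map `mulHom`) and integrable
against every Haar measure `μ_U` of `U(1,1)`, and the product formula for the Haar measure of `U(1,1)`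
(`T5U11Product.integral_eq_of_scalar_invariant`) gives

  `c_U • ∫_{U(1,1)} ⟨π_k(g) f₁, h₁⟩_k conj ⟨π_k(g) f₂, h₂⟩_k dμ_U = π ⟨f₁, f₂⟩_k ⟨h₂, h₁⟩_k / (k - 1)`

(`integral_matrixCoeffU_mul_conj`), `c_U = haarScalarFactor (map mulHom (haarCircle ⊗ ν)) μ_U`, for all
holomorphic `f₁, f₂, h₁, h₂ ∈ A_k`, `k ≥ 2`.

Blind lane: Mathlib + the HodgeRepro2 prefix only; no sorry; axioms ⊆ {propext, Classical.choice,
Quot.sound}.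
-/

namespace Summit.Ventures.HodgeRepro2.T5BergmanSchurPolarizedU11

open MeasureTheory MeasureTheory.Measure Metric Filter Topology
open T5PoincareMeasure T5SU11Unimodular T5U11Unimodular T5U11Product T5SU11Fibration
  T5SU11FibrationHaar T5SU11FibrationCartan T5HaarCircle T5SU11CoefficientL2 T5U11CoefficientL2
open T5BergmanCoefficient T5BergmanPairing T5BergmanUnitary T5BergmanCoefficientL2 T5BergmanU11
  T5BergmanParseval T5BergmanFourier T5BergmanKernel T5BergmanSchur T5BergmanActStable
  T5BergmanMatrixCoeff T5BergmanCoeffOrtho T5BergmanSchurGeneral T5BergmanSchurU11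
  T5BergmanSchurPolarized T5BergmanSchurGeneralU11
open scoped Real

/-- The product of two coefficients at `λ g` is the product at `g` (the central character cancels). -/
theorem matrixCoeffU_mul_conj_mulHom (k : ℕ) (f₁ h₁ f₂ h₂ : ℂ → ℂ) (lam : Circle) (g : SU11) :
    matrixCoeffU k f₁ h₁ (mulHom (lam, g)) * (starRingEnd ℂ) (matrixCoeffU k f₂ h₂ (mulHom (lam, g))) =
      matrixCoeff k f₁ h₁ g * (starRingEnd ℂ) (matrixCoeff k f₂ h₂ g) := by
  rw [matrixCoeffU_mulHom, matrixCoeffU_mulHom, map_mul, map_pow]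
  have h1 : (lam : ℂ) ^ k * (starRingEnd ℂ) (lam : ℂ) ^ k = 1 := by
    rw [← mul_pow, Complex.mul_conj, Complex.normSq_eq_norm_sq, Circle.norm_coe, one_pow,
      Complex.ofReal_one, one_pow]
  linear_combination (matrixCoeff k f₁ h₁ g * (starRingEnd ℂ) (matrixCoeff k f₂ h₂ g)) * h1

/-- The product of two coefficients is invariant under left multiplication by the centre. -/
theorem matrixCoeffU_mul_conj_scalarHom_mul (k : ℕ) (f₁ h₁ f₂ h₂ : ℂ → ℂ) (lam : Circle) (g : U11) :
    matrixCoeffU k f₁ h₁ (scalarHom lam * g) * (starRingEnd ℂ) (matrixCoeffU k f₂ h₂ (scalarHom lam * g)) =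
      matrixCoeffU k f₁ h₁ g * (starRingEnd ℂ) (matrixCoeffU k f₂ h₂ g) := by
  obtain ⟨⟨mu, g'⟩, rfl⟩ := mulHom_surjective g
  have e : scalarHom lam * mulHom (mu, g') = mulHom (lam * mu, g') := by
    rw [mulHom_apply, mulHom_apply, map_mul, mul_assoc]
  rw [e, matrixCoeffU_mul_conj_mulHom, matrixCoeffU_mul_conj_mulHom]

/-- The product of two coefficients is continuous on `U(1,1)` for holomorphic `f₁, h₁, f₂, h₂ ∈ A_k`. -/
theorem continuous_matrixCoeffU_mul_conj (k : ℕ) (hk : 2 ≤ k) (f₁ h₁ f₂ h₂ : ℂ → ℂ)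
    (hf₁ : DifferentiableOn ℂ f₁ (ball 0 1))
    (hf₁int : IntegrableOn (fun w => ‖f₁ w‖ ^ 2 * (1 - ‖w‖ ^ 2) ^ (k - 2)) (ball (0 : ℂ) 1))
    (hh₁ : DifferentiableOn ℂ h₁ (ball 0 1))
    (hh₁int : IntegrableOn (fun w => ‖h₁ w‖ ^ 2 * (1 - ‖w‖ ^ 2) ^ (k - 2)) (ball (0 : ℂ) 1))
    (hf₂ : DifferentiableOn ℂ f₂ (ball 0 1))
    (hf₂int : IntegrableOn (fun w => ‖f₂ w‖ ^ 2 * (1 - ‖w‖ ^ 2) ^ (k - 2)) (ball (0 : ℂ) 1))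
    (hh₂ : DifferentiableOn ℂ h₂ (ball 0 1))
    (hh₂int : IntegrableOn (fun w => ‖h₂ w‖ ^ 2 * (1 - ‖w‖ ^ 2) ^ (k - 2)) (ball (0 : ℂ) 1)) :
    Continuous fun g : U11 =>
      matrixCoeffU k f₁ h₁ g * (starRingEnd ℂ) (matrixCoeffU k f₂ h₂ g) := by
  rw [isQuotientMap_mulHom.continuous_iff]
  have e : ((fun g : U11 => matrixCoeffU k f₁ h₁ g * (starRingEnd ℂ) (matrixCoeffU k f₂ h₂ g)) ∘
      mulHom) = fun p : Circle × SU11 =>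
        matrixCoeff k f₁ h₁ p.2 * (starRingEnd ℂ) (matrixCoeff k f₂ h₂ p.2) := by
    ext p
    exact matrixCoeffU_mul_conj_mulHom k f₁ h₁ f₂ h₂ p.1 p.2
  rw [e]
  exact ((continuous_matrixCoeff_of_differentiableOn k hk f₁ hf₁ hf₁int h₁ hh₁ hh₁int).comp
    continuous_snd).mul (Complex.continuous_conj.comp
      ((continuous_matrixCoeff_of_differentiableOn k hk f₂ hf₂ hf₂int h₂ hh₂ hh₂int).comp
        continuous_snd))

variable [MeasurableSpace Circle] [BorelSpace Circle]

/-- The relations against the fibration measure `ν = π μ_R` of `SU(1,1)`, with integrability. -/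
theorem integral_matrixCoeff_mul_conj_nu (k : ℕ) (hk : 2 ≤ k) (f₁ h₁ f₂ h₂ : ℂ → ℂ)
    (hf₁ : DifferentiableOn ℂ f₁ (ball 0 1))
    (hf₁int : IntegrableOn (fun w => ‖f₁ w‖ ^ 2 * (1 - ‖w‖ ^ 2) ^ (k - 2)) (ball (0 : ℂ) 1))
    (hh₁ : DifferentiableOn ℂ h₁ (ball 0 1))
    (hh₁int : IntegrableOn (fun w => ‖h₁ w‖ ^ 2 * (1 - ‖w‖ ^ 2) ^ (k - 2)) (ball (0 : ℂ) 1))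
    (hf₂ : DifferentiableOn ℂ f₂ (ball 0 1))
    (hf₂int : IntegrableOn (fun w => ‖f₂ w‖ ^ 2 * (1 - ‖w‖ ^ 2) ^ (k - 2)) (ball (0 : ℂ) 1))
    (hh₂ : DifferentiableOn ℂ h₂ (ball 0 1))
    (hh₂int : IntegrableOn (fun w => ‖h₂ w‖ ^ 2 * (1 - ‖w‖ ^ 2) ^ (k - 2)) (ball (0 : ℂ) 1)) :
    Integrable (fun g => matrixCoeff k f₁ h₁ g * (starRingEnd ℂ) (matrixCoeff k f₂ h₂ g))
        (nu haarCircle) ∧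
      ∫ g, matrixCoeff k f₁ h₁ g * (starRingEnd ℂ) (matrixCoeff k f₂ h₂ g) ∂(nu haarCircle) =
        (π : ℂ) * (pairing k f₁ f₂ * pairing k h₂ h₁ / ((k : ℂ) - 1)) := by
  have hi := integrable_matrixCoeff_mul_conj k hk f₁ h₁ f₂ h₂ hf₁ hf₁int hh₁ hh₁int hf₂ hf₂int hh₂
    hh₂int
  have he := schur_relations k hk f₁ f₂ h₁ h₂ hf₁ hf₁int hf₂ hf₂int hh₁ hh₁int hh₂ hh₂int
  have hπ : (0 : ℝ) < π := Real.pi_pos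
  have hc0 : ENNReal.ofReal π⁻¹ ≠ 0 := by
    rw [Ne, ENNReal.ofReal_eq_zero]
    exact not_le.mpr (inv_pos.mpr hπ)
  unfold ruhl at hi he
  rw [integrable_smul_measure hc0 ENNReal.ofReal_ne_top] at hi
  rw [integral_smul_measure, ENNReal.toReal_ofReal (by positivity), Complex.real_smul,
    Complex.ofReal_inv] at he
  refine ⟨hi, ?_⟩
  rw [← he]
  have hπc : (π : ℂ) ≠ 0 := by exact_mod_cast hπ.ne'
  field_simp

variable [MeasurableSpace U11] [BorelSpace U11]

/-- The product of two coefficients is integrable against every Haar measure of `U(1,1)`. -/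
theorem integrable_matrixCoeffU_mul_conj (μU : Measure U11) [IsHaarMeasure μU] (k : ℕ) (hk : 2 ≤ k)
    (f₁ h₁ f₂ h₂ : ℂ → ℂ) (hf₁ : DifferentiableOn ℂ f₁ (ball 0 1))
    (hf₁int : IntegrableOn (fun w => ‖f₁ w‖ ^ 2 * (1 - ‖w‖ ^ 2) ^ (k - 2)) (ball (0 : ℂ) 1))
    (hh₁ : DifferentiableOn ℂ h₁ (ball 0 1))
    (hh₁int : IntegrableOn (fun w => ‖h₁ w‖ ^ 2 * (1 - ‖w‖ ^ 2) ^ (k - 2)) (ball (0 : ℂ) 1))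
    (hf₂ : DifferentiableOn ℂ f₂ (ball 0 1))
    (hf₂int : IntegrableOn (fun w => ‖f₂ w‖ ^ 2 * (1 - ‖w‖ ^ 2) ^ (k - 2)) (ball (0 : ℂ) 1))
    (hh₂ : DifferentiableOn ℂ h₂ (ball 0 1))
    (hh₂int : IntegrableOn (fun w => ‖h₂ w‖ ^ 2 * (1 - ‖w‖ ^ 2) ^ (k - 2)) (ball (0 : ℂ) 1)) :
    Integrable (fun g => matrixCoeffU k f₁ h₁ g * (starRingEnd ℂ) (matrixCoeffU k f₂ h₂ g)) μU := by
  set c := haarScalarFactor (map mulHom (haarCircle.prod (nu haarCircle))) μU with hc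
  have hc0 : c ≠ 0 := (T5U11Product.haarScalarFactor_pos haarCircle (nu haarCircle) μU).ne'
  have hmap : map mulHom (haarCircle.prod (nu haarCircle)) = c • μU :=
    map_mulHom_prod_eq_smul haarCircle (nu haarCircle) μU
  have hmeas : AEStronglyMeasurable
      (fun g => matrixCoeffU k f₁ h₁ g * (starRingEnd ℂ) (matrixCoeffU k f₂ h₂ g))
      (map mulHom (haarCircle.prod (nu haarCircle))) :=
    (continuous_matrixCoeffU_mul_conj k hk f₁ h₁ f₂ h₂ hf₁ hf₁int hh₁ hh₁int hf₂ hf₂int hh₂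
      hh₂int).aestronglyMeasurable
  have hint' : Integrable
      (fun g => matrixCoeffU k f₁ h₁ g * (starRingEnd ℂ) (matrixCoeffU k f₂ h₂ g))
      (map mulHom (haarCircle.prod (nu haarCircle))) := by
    rw [integrable_map_measure hmeas continuous_mulHom.measurable.aemeasurable]
    have e : ((fun g => matrixCoeffU k f₁ h₁ g * (starRingEnd ℂ) (matrixCoeffU k f₂ h₂ g)) ∘
        mulHom) = fun q : Circle × SU11 =>
          matrixCoeff k f₁ h₁ q.2 * (starRingEnd ℂ) (matrixCoeff k f₂ h₂ q.2) := by
      ext q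
      exact matrixCoeffU_mul_conj_mulHom k f₁ h₁ f₂ h₂ q.1 q.2
    rw [e]
    exact (integral_matrixCoeff_mul_conj_nu k hk f₁ h₁ f₂ h₂ hf₁ hf₁int hh₁ hh₁int hf₂ hf₂int hh₂
      hh₂int).1.comp_snd haarCircle
  rw [hmap] at hint'
  exact (integrable_smul_measure (ENNReal.coe_ne_zero.mpr hc0) ENNReal.coe_ne_top).mp hint'

/-- **The Schur orthogonality relations on `H_j = U(1,1)`**:
`c_U • ∫_{U(1,1)} ⟨π_k(g) f₁, h₁⟩_k conj ⟨π_k(g) f₂, h₂⟩_k dμ_U = π ⟨f₁, f₂⟩_k ⟨h₂, h₁⟩_k / (k-1)` for every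
Haar measure `μ_U` of `U(1,1)` and all holomorphic `f₁, f₂, h₁, h₂ ∈ A_k`,
`c_U = haarScalarFactor (map mulHom (haarCircle ⊗ ν)) μ_U`. -/
theorem integral_matrixCoeffU_mul_conj (μU : Measure U11) [IsHaarMeasure μU] (k : ℕ) (hk : 2 ≤ k)
    (f₁ h₁ f₂ h₂ : ℂ → ℂ) (hf₁ : DifferentiableOn ℂ f₁ (ball 0 1))
    (hf₁int : IntegrableOn (fun w => ‖f₁ w‖ ^ 2 * (1 - ‖w‖ ^ 2) ^ (k - 2)) (ball (0 : ℂ) 1))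
    (hh₁ : DifferentiableOn ℂ h₁ (ball 0 1))
    (hh₁int : IntegrableOn (fun w => ‖h₁ w‖ ^ 2 * (1 - ‖w‖ ^ 2) ^ (k - 2)) (ball (0 : ℂ) 1))
    (hf₂ : DifferentiableOn ℂ f₂ (ball 0 1))
    (hf₂int : IntegrableOn (fun w => ‖f₂ w‖ ^ 2 * (1 - ‖w‖ ^ 2) ^ (k - 2)) (ball (0 : ℂ) 1))
    (hh₂ : DifferentiableOn ℂ h₂ (ball 0 1))
    (hh₂int : IntegrableOn (fun w => ‖h₂ w‖ ^ 2 * (1 - ‖w‖ ^ 2) ^ (k - 2)) (ball (0 : ℂ) 1)) :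
    (haarScalarFactor (map mulHom (haarCircle.prod (nu haarCircle))) μU : ℝ) •
      ∫ g, matrixCoeffU k f₁ h₁ g * (starRingEnd ℂ) (matrixCoeffU k f₂ h₂ g) ∂μU =
        (π : ℂ) * (pairing k f₁ f₂ * pairing k h₂ h₁ / ((k : ℂ) - 1)) := by
  rw [integral_eq_of_scalar_invariant haarCircle (nu haarCircle) μU _
    (integrable_matrixCoeffU_mul_conj μU k hk f₁ h₁ f₂ h₂ hf₁ hf₁int hh₁ hh₁int hf₂ hf₂int hh₂ hh₂int)
    (matrixCoeffU_mul_conj_scalarHom_mul k f₁ h₁ f₂ h₂), haarCircle_univ, ENNReal.toReal_one,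
    one_smul]
  simp_rw [matrixCoeffU_incl]
  exact (integral_matrixCoeff_mul_conj_nu k hk f₁ h₁ f₂ h₂ hf₁ hf₁int hh₁ hh₁int hf₂ hf₂int hh₂
    hh₂int).2

end Summit.Ventures.HodgeRepro2.T5BergmanSchurPolarizedU11
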